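import Summits.ResolutionOfSingularities.ResolutionOfSingularities.Theorems.MarkedTransferCampaignG1PnegaInterfaceV3
import Literature.AlgebraicGeometry.Hironaka2017.Proofs.S07Permissible.Thm7p11
import Literature.AlgebraicGeometry.Hironaka2017.Lib.PowIdeal
import HarnessLib

/-!
# [OURS · L1 G1 ℘nega-INTERFACE] Obligation **F3.1** — the Diff-stability instance CONSUMED by Th. 7.11 (1), p.38 L26–L28 —
# over the checklist of record `Campaign.PnegaInterfaceV3` (p487629). Data-level kernel by res-D-pv-031 (res-D-plan-1 ROUTING #8 (e)
# 2026-08-27T02:04:02Z; draft `D/res-D-pv-031/PnegaObligationF31.draft.lean` sha16 645c8253142fb424, farm-clean), carried summit-side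
# by the typer of record res-L1-type-o2 (namespace `…Campaign.PnegaObligation`, guard = the tree's `Campaign.IsCharFiltration`,
# + §6 the instantiation `PnegaInterfaceV3.F31` and its kernel cell); Lean terms of §1–§5 otherwise byte-identical to the draft.

WHY A SEPARATE OBLIGATION (res-adj-1 ℘nega-INTERFACE CHECK 2026-08-27T01:41:03Z C1, ADOPTED by res-D-plan-1's V3 RULING 01:55:32Z):
the V3 structure keeps only F3⁻ `diff_mem_neg` (Diff-stability from NEGATIVE source degrees); the CONSUMED crossing instances
F3.1 (Th 7.11 (1) p.38 L26–L28), F3.2 (Th 14.1 proof p.68 L19–L20), F3.3 (§9.3 `⊟(g,a) ⊂ ℘̃`), F3.4 (Rem 11.4 p.63 L31–L33) are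
SEPARATE named obligation `def`s over the structure, each with the consumer's own source / operator family, scored N/A until typed.
This file types F3.1.

## §1–§2 What p.38 L25–L30 does with Th. 7.11 (1) «Diff^{(c)}_Z ℘̃(E,j) ⊂ ℘̃(E,j−c), j ≠ 0, c > 0» (typed `Thm7_11_1 K P m`)
Three (source, target) regimes, of which exactly ONE crosses the degree boundary:
* (pos→pos) `0 < c < j`: L25–L26 «if j > 0 then ℘̃(E,j) = ℘posi(E,j) and hence the inclusion is … by the property of ℘(E) with
  c ≤ j» — for a candidate with `pos_eq` this is the GUARD's Th 4.1-shape Diff-stability of `℘` (`IsCharFiltration`, clause 4: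
  `posPosAt_of_guard`); for the printed `℘̃` even hypothesis-free (`Thm7_11_1_pos_target` p477448). NOT an obligation.
* (pos→nonpos) `0 < j ≤ c`: L26–L27 «or by the definition Eq.(36) of ℘̃(E, j−c) with c > j» (plus the boundary `c = j`, which the
  printed case split files under «c ≤ j» although its target is `℘̃(E,0)`, not `℘(E,0)` — Rem 5.4) — THIS is **F3.1**: every
  differential operator of order `≤ c`, `c ≥ j > 0`, maps the positive piece `℘(E,j)` into the non-positive piece `℘̃(E,j−c)`.
  The sentence restricts NEITHER the operator family (all of `Diff^{(c)}`, every `c ≥ j`) NOR the source inside `℘(E,j)`;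
  `F31At` / `F31` below carry exactly that family.
* (neg source) `j < 0`: L27–L30 — Diff-stability from NEGATIVE sources = V3's structure field F3⁻ `diff_mem_neg`; not part of
  F3.1 (`F3negAt` below restates it pointwise, `c > 0` as printed).
`thm7111ShapeAt_iff` (§2): for a candidate whose positive pieces at `P` are the `P j` (`pos_eq`-shape), the Th 7.11 (1)-shape
statement is EQUIVALENT to (pos→pos) ∧ F3.1 ∧ F3⁻ at `P`; so F3.1 is precisely what Th 7.11 (1) adds across the boundary.

## §3 Which TREE binder F3.1 discharges
At the printed candidate `printedTildeAt K P m i := (pTilde K P m i).toAddSubgroup` (row 008 `℘̃(E,i)`), the typed `Thm7_11_1 K P m`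
IS `Thm7111ShapeAt K (printedTildeAt K P m)` (`thm7_11_1_iff_shape`), hence `Thm7_11_1 K P m ↔ PosPos ∧ F31At ∧ F3neg` at the
printed value (`thm7_11_1_iff_parts`). The lane's `Thm7_11_1_of` (res-D-pv-036 `Proofs/S07Permissible/Thm7p11.lean` p477448, Tier A
R56) derives the whole of it from ONE binder `hR01 : ∀ a : ℕ, pTildeNeg K P m a = ⊤` (R01 collapse; class CONTENT-FREE:R01);
`F31At_printed_of_collapse` isolates the F3.1 third: **F3.1 ↦ the binder `hR01` of `Thm7_11_1_of`**; no other landed theorem binds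
Th 7.11 (1) (its typed consumers are the §9 slot hypotheses = F3.3, and Th 7.12 / Lem 16.11 via Th 7.8 = F1).

## §4 KERNEL FINDING (scoring input, not a verdict): F3.1 with the sentence's own operator family is LETHAL with F7b-unit
`F31At_forces_one_mem`: `F31At K (tilde P) P` at a `P` carrying a (37)-datum (`g ∈ P q`, `0 < q`, unit clause
`diffIdeal K q (span {g}) = ⊤` — the `k = 1` instance of V3's `∀ k > 0, diffIdeal K (k q) (span {g^k}) = ⊤`) puts `1 ∈ tilde P (−a)`
for EVERY `a ≥ 0`, using only that order-`≤ q` operators form a `B`-module (`IsDiffOpLE.smul`) and additivity — no `OStable`, no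
F2/F8, no guard; `F31At_false_of_negProper`. §6 lifts it to the checklist: `PnegaInterfaceV3.not_F31_of_datum` — NO inhabitant of
`PnegaInterfaceV3` meets F3.1 once one guarded (37)-placement exists (F7b-unit `neg_proper` is a structure field). I.e. Th 7.11 (1)
AS TYPED is itself a collapse-class demand (res-adj-1's `squeeze_pos_source` localised to the single source degree `q` and to
p.38 L26–L27); any survivable operator restriction must come from the DOWNSTREAM uses (p.39 l.10–11 «due to Eq.(83) and Eq.(84)» =
F3.3; Th 14.1 p.68 = F3.2), not from this sentence. Recommended cell text (res-D-pv-031): «F3.1 literal: ✗-by-kernel for every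
F7b-candidate; not discriminating; content carried by F3.2 / F3.3».

## §5 Companion certificate E-G (V3 field `diff_mem_neg`): order-0 operators force `B`-stability below 0
`oStableNeg_of_F3negAll`: `IsDiffOpLE K μ` contains every multiplication (`isDiffOpLE_mulLeft` + `of_le`), so F3⁻ AS TYPED (all
`μ`, `μ = 0` included) makes every negative piece `B`-stable; with F6d `NormDemand` (`q ≥ 2`) at a regular local placement of
positive dimension the tree squeeze `Lib.PowIdeal.addSubgroup_eq_bot_of_mul_mem_of_subset_range_pow` empties all negative pieces
(`tilde_neg_eq_bot_of_F3negAll_of_normDemand`; even from the as-printed `c > 0` form: `tilde_neg_eq_bot_of_F3neg_of_normDemand`) ⇒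
in V3 as filed, F6d ✓ ⇒ F7c ✗ for every inhabitant (= res-type-087's `PnegaInterfaceV3.not_normDemand_of_oStable_of_nonVanishing`
family, `MarkedTransferCampaignG1PnegaSqueezeV3.lean` p488544, reached here without `OStable` as a hypothesis). Reported for
res-D-plan-1 to rule on the operator family of F3⁻ (Grothendieck `IsDiffOpLE` ⊇ all multiplications vs a Hasse–Schmidt-type family).

HONEST FRAMING. Nothing here is a statement of H. Hironaka's manuscript *Resolution of singularities in positive characteristics*
(2017-03-23, [Hironaka2017], lit key `paper:url-3343fd9e678b`): Th 7.11 (1) is a CANDIDATE [claim: Hironaka2017, status: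
under-review] and enters only as the SHAPE of an obligation; every `def` here is OURS, asserted of no candidate; the theorems are
bookkeeping about typed statements. AI typing / AI kernel work, weaker than expert review; nothing here is progress on resolution of
singularities in positive characteristic; no claim beyond the kernel.
-/

noncomputable section

set_option linter.dupNamespace false -- mandated namespace of this single-conjunct summit

namespace Summit.ResolutionOfSingularities.ResolutionOfSingularities.Theorems.Campaign.PnegaObligation

open Literature.AlgebraicGeometry.Resolution
open Literature.AlgebraicGeometry.Hironaka2017.S05NegativePart
open Literature.AlgebraicGeometry.Hironaka2017.S07Permissible
open IsLocalRing

universe u v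

/-- The type of a candidate family (V2/V3 field `tilde`): `tilde P i` = «℘̃(E,i)» computed from `P j = ℘(E,j)`, an additive
subgroup of the `K`-algebra `B` in each degree `i ∈ ℤ`. [folklore] -/
abbrev TildeFamily (K : Type u) [CommRing K] : Type (max u (v + 1)) :=
  ∀ {B : Type v} [CommRing B] [Algebra K B], (ℕ → Ideal B) → ℤ → AddSubgroup B

/-! ## §1 The obligation F3.1 (data level) and the two other regimes of Th. 7.11 (1) -/

/-- **F3.1 at one filtration `P`** — the crossing instance of Th. 7.11 (1) consumed at p.38 L26–L27 («or by the definition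
Eq.(36) of `℘̃(E, j−c)` with `c > j`», boundary `c = j` included): for every `c`, every differential operator `D` of order `≤ c`
(tree `Resolution.IsDiffOpLE`), every POSITIVE source degree `j` with `0 < j ≤ c` and every `f ∈ ℘(E,j) = P j`, the value `D f`
lies in the NON-POSITIVE piece `tildeP (j − c)`. Source family = all of `P j`; operator family = all of `Diff^{(c)}`, `c ≥ j` (the
sentence restricts neither). OURS obligation shape for [claim: Hironaka2017, status: under-review] Th 7.11 (1) p.38 L22–L23,
proof L26–L27. [folklore] -/
def F31At (K : Type u) [CommRing K] {B : Type v} [CommRing B] [Algebra K B]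
    (tildeP : ℤ → AddSubgroup B) (P : ℕ → Ideal B) : Prop :=
  ∀ (c : ℕ) (D : B →ₗ[K] B), IsDiffOpLE K c D →
    ∀ j : ℕ, 0 < j → j ≤ c → ∀ f : B, f ∈ P j → D f ∈ tildeP ((j : ℤ) - c)

/-- **F3.1** (the obligation over a candidate family, guarded like every V3 field): `F31At` at every `K`-algebra `B` and every
filtration `P` satisfying the guard `Campaign.IsCharFiltration K P` (V3, res-adj-1 C2). Under V3: `PnegaInterfaceV3.F31 I := F31 K I.tilde`
(§6). OURS; asserted of no candidate. [folklore] -/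
def F31 (K : Type u) [CommRing K] (tilde : TildeFamily.{u, v} K) : Prop :=
  ∀ {B : Type v} [CommRing B] [Algebra K B] (P : ℕ → Ideal B), IsCharFiltration K P → F31At K (tilde P) P

/-- F3⁻ at one `P`, AS PRINTED in Th. 7.11 (1) (`j < 0`, `c > 0`): operators of order `≤ c` map `tildeP i` into `tildeP (i − c)`
for NEGATIVE `i` (pointwise; V3's field `diff_mem_neg` is this with every `c ≥ 0`, see `F3negAllAt`). [folklore] -/
def F3negAt (K : Type u) [CommRing K] {B : Type v} [CommRing B] [Algebra K B] (tildeP : ℤ → AddSubgroup B) : Prop :=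
  ∀ (c : ℕ) (D : B →ₗ[K] B), IsDiffOpLE K c D → 0 < c →
    ∀ i : ℤ, i < 0 → ∀ f : B, f ∈ tildeP i → D f ∈ tildeP (i - c)

/-- V3 v0.4's field `diff_mem_neg` at one `P`, VERBATIM in shape (every order `μ`, INCLUDING `μ = 0`). [folklore] -/
def F3negAllAt (K : Type u) [CommRing K] {B : Type v} [CommRing B] [Algebra K B] (tildeP : ℤ → AddSubgroup B) : Prop :=
  ∀ (μ : ℕ) (D : B →ₗ[K] B), IsDiffOpLE K μ D → ∀ i : ℤ, i < 0 → ∀ f : B, f ∈ tildeP i → D f ∈ tildeP (i - μ)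

/-- (pos→pos) at one `P`: operators of order `≤ c`, `0 < c < j`, map `tildeP j` into `tildeP (j − c)`. [folklore] -/
def PosPosAt (K : Type u) [CommRing K] {B : Type v} [CommRing B] [Algebra K B] (tildeP : ℤ → AddSubgroup B) : Prop :=
  ∀ (c : ℕ) (D : B →ₗ[K] B), IsDiffOpLE K c D → 0 < c →
    ∀ j : ℕ, c < j → ∀ f : B, f ∈ tildeP (j : ℤ) → D f ∈ tildeP ((j : ℤ) - c)

/-- The Th. 7.11 (1)-SHAPE for a candidate at one `P` (the typed `Thm7_11_1` with `℘̃(E,·) ↦ tildeP`, pointwise): for `j ≠ 0`,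
`c > 0`, every operator of order `≤ c` maps `tildeP j` into `tildeP (j − c)`. [folklore] -/
def Thm7111ShapeAt (K : Type u) [CommRing K] {B : Type v} [CommRing B] [Algebra K B] (tildeP : ℤ → AddSubgroup B) : Prop :=
  ∀ j : ℤ, j ≠ 0 → ∀ c : ℕ, 0 < c → ∀ D : B →ₗ[K] B, IsDiffOpLE K c D →
    ∀ f : B, f ∈ tildeP j → D f ∈ tildeP (j - c)

/-! ## §2 F3.1 is exactly the crossing third of Th. 7.11 (1) -/

section Decomposition

variable (K : Type u) [CommRing K] {B : Type v} [CommRing B] [Algebra K B]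

/-- **Decomposition.** If the candidate's positive pieces at `P` are the `P j` (`pos_eq`-shape), the Th 7.11 (1)-shape statement
is equivalent to (pos→pos) ∧ F3.1 ∧ F3⁻ at `P`. [folklore] -/
theorem thm7111ShapeAt_iff (tildeP : ℤ → AddSubgroup B) (P : ℕ → Ideal B)
    (hpos : ∀ j : ℕ, 0 < j → tildeP (j : ℤ) = (P j).toAddSubgroup) :
    Thm7111ShapeAt K tildeP ↔ PosPosAt K tildeP ∧ F31At K tildeP P ∧ F3negAt K tildeP := by
  constructor
  · intro h
    refine ⟨fun c D hD hc j hcj f hf => ?_, fun c D hD j hj hjc f hf => ?_, fun c D hD hc i hi f hf => ?_⟩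
    · have hj0 : ((j : ℕ) : ℤ) ≠ 0 := by exact_mod_cast (show j ≠ 0 by omega)
      exact h j hj0 c hc D hD f hf
    · have hj0 : ((j : ℕ) : ℤ) ≠ 0 := by exact_mod_cast hj.ne'
      have hf' : f ∈ tildeP (j : ℤ) := by rw [hpos j hj]; exact hf
      exact h j hj0 c (lt_of_lt_of_le hj hjc) D hD f hf'
    · exact h i hi.ne c hc D hD f hf
  · rintro ⟨hpp, h31, hneg⟩ j hj0 c hc D hD f hf
    rcases lt_trichotomy j 0 with hj | hj | hj
    · exact hneg c D hD hc j hj f hf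
    · exact absurd hj hj0
    · obtain ⟨jn, rfl⟩ := Int.eq_ofNat_of_zero_le hj.le
      have hjn : 0 < jn := by exact_mod_cast hj
      rcases le_or_gt jn c with hle | hlt
      · have hf' : f ∈ P jn := by
          have := hpos jn hjn
          rw [this] at hf
          exact hf
        exact h31 c D hD jn hjn hle f hf'
      · exact hpp c D hD hc jn hlt f hf

/-- (pos→pos) is the GUARD's business for a candidate with `pos_eq`-shape at `P`: clause 4 of `IsCharFiltration` gives it
outright. [folklore] -/
theorem posPosAt_of_guard (tildeP : ℤ → AddSubgroup B) (P : ℕ → Ideal B) (hP : IsCharFiltration K P)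
    (hpos : ∀ j : ℕ, 0 < j → tildeP (j : ℤ) = (P j).toAddSubgroup) : PosPosAt K tildeP := by
  intro c D hD _hc j hcj f hf
  have hf' : f ∈ P j := by
    have := hpos j (by omega)
    rw [this] at hf
    exact hf
  have hmem : D f ∈ P (j - c) := hP.2.2.2 j c hcj (apply_mem_diffIdeal K hD hf')
  have hjc : ((j : ℤ) - c) = ((j - c : ℕ) : ℤ) := by push_cast [Nat.cast_sub hcj.le]; ring
  rw [hjc, hpos (j - c) (by omega)]
  exact hmem

end Decomposition

/-! ## §3 The printed candidate: F3.1 is the `j − c ≤ 0 < j` third of `Thm7_11_1`, discharged by the collapse binder `hR01` -/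

section Printed

variable (K : Type u) [CommRing K] {A : Type v} [CommRing A] [Algebra K A]

/-- The printed value at `P`: `i ↦ ℘̃(E,i) = pTilde K P m i` (row 008), as additive subgroups. [folklore] -/
def printedTildeAt (P : ℕ → Ideal A) (m : ℕ) (i : ℤ) : AddSubgroup A :=
  (pTilde K P m i).toAddSubgroup

/-- The typed `Thm7_11_1 K P m` IS the Th 7.11 (1)-shape at the printed value (unfolding `diffIdeal_le_iff`). [folklore] -/
theorem thm7_11_1_iff_shape (P : ℕ → Ideal A) (m : ℕ) :
    Thm7_11_1 K P m ↔ Thm7111ShapeAt K (printedTildeAt K P m) := by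
  constructor
  · intro h j hj c hc D hD f hf
    exact (diffIdeal_le_iff K).1 (h j hj c hc) D hD f hf
  · intro h j hj c hc
    exact (diffIdeal_le_iff K).2 fun D hD f hf => h j hj c hc D hD f hf

/-- Hence `Thm7_11_1 K P m ↔ (pos→pos) ∧ F3.1 ∧ F3⁻` at the printed value whenever the positive pieces are the `P j` — which for
the printed `℘̃` holds exactly when `m ∣ j`-type identities hold (Lem 5.2 OURS `_dvd`; R87 otherwise); stated with that identity
as a hypothesis so that nothing about Lem 5.2 is asserted. [folklore] -/
theorem thm7_11_1_iff_parts (P : ℕ → Ideal A) (m : ℕ)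
    (hpos : ∀ j : ℕ, 0 < j → pTilde K P m (j : ℤ) = P j) :
    Thm7_11_1 K P m ↔ PosPosAt K (printedTildeAt K P m) ∧ F31At K (printedTildeAt K P m) P ∧
      F3negAt K (printedTildeAt K P m) := by
  rw [thm7_11_1_iff_shape]
  exact thm7111ShapeAt_iff K _ P fun j hj => by
    show (pTilde K P m (j : ℤ)).toAddSubgroup = _
    rw [hpos j hj]

/-- **The tree binder F3.1 discharges, at the printed candidate**: the R01 collapse `hR01 : ∀ a : ℕ, ℘̃(E,−a)_ξ = ⊤` — the ONE
binder of `Thm7_11_1_of` (res-D-pv-036 p477448; Tier A R56, class CONTENT-FREE:R01) — gives F3.1 at `P` (targets `j − c ≤ 0` are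
the unit ideal, `Thm7p11.pTilde_eq_top_of_collapse`). content-free. [folklore] -/
theorem F31At_printed_of_collapse (P : ℕ → Ideal A) (m : ℕ) (hR01 : ∀ a : ℕ, pTildeNeg K P m (a : ℤ) = ⊤) :
    F31At K (printedTildeAt K P m) P := by
  intro c D _hD j _hj hjc f _hf
  show D f ∈ (pTilde K P m ((j : ℤ) - c)).toAddSubgroup
  rw [Thm7p11.pTilde_eq_top_of_collapse K hR01 (by omega)]
  trivial

end Printed

/-! ## §4 Lethality: F3.1 at a (37)-datum puts `1` into every non-positive piece -/

section Lethal

variable (K : Type u) [CommRing K] {B : Type v} [CommRing B] [Algebra K B]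

/-- **F3.1 ⇒ `1 ∈ tilde P (−a)` for every `a ≥ 0` at a (37)-datum** (`g ∈ P q`, `0 < q`, unit clause
`diffIdeal K q (span {g}) = ⊤`). Mechanism: `diffIdeal K q (span {g})` is the IDEAL spanned by the values `D f`, `ord D ≤ q`,
`f ∈ (g)`; since `b • D` is again of order `≤ q` (`IsDiffOpLE.smul`), the set `T := {x | ∀ b, b·x ∈ tilde P (q − c)}` contains all
those values once F3.1 holds with `j := q ≤ c`, and `T` is closed under `+`, `0` and `B`-scaling, so `1 ∈ ⊤ = span ⊆ T`; take
`b := 1`. No `OStable`, no F2/F8, no guard. [folklore] -/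
theorem F31At_forces_one_mem (tildeP : ℤ → AddSubgroup B) (P : ℕ → Ideal B) (h31 : F31At K tildeP P)
    {q : ℕ} (hq : 0 < q) {g : B} (hg : g ∈ P q) (h37 : diffIdeal K q (Ideal.span {g}) = ⊤) (a : ℕ) :
    (1 : B) ∈ tildeP (-(a : ℤ)) := by
  -- the `B`-saturated part of the target piece, as a submodule of `B`
  let T : Submodule B B :=
    { carrier := {x | ∀ b : B, b * x ∈ tildeP ((q : ℤ) - (q + a : ℕ))}
      zero_mem' := fun b => by rw [mul_zero]; exact AddSubgroup.zero_mem _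
      add_mem' := fun {x y} hx hy b => by rw [mul_add]; exact AddSubgroup.add_mem _ (hx b) (hy b)
      smul_mem' := fun r {x} hx b => by
        show b * (r • x) ∈ _
        rw [smul_eq_mul, ← mul_assoc]
        exact hx (b * r) }
  have hle : diffIdeal K q (Ideal.span {g}) ≤ T := by
    refine Ideal.span_le.2 ?_
    rintro _ ⟨D, hD, f, hf, rfl⟩ b
    have hbD : IsDiffOpLE K (q + a) (b • D) := (hD.smul b).of_le (by omega)
    have := h31 (q + a) (b • D) hbD q hq (by omega) f (Ideal.span_singleton_le_iff_mem _ |>.2 hg hf)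
    simpa using this
  have h1 : (1 : B) ∈ T := hle (h37 ▸ Submodule.mem_top)
  have := h1 1
  rw [mul_one] at this
  have hdeg : ((q : ℤ) - (q + a : ℕ)) = -(a : ℤ) := by push_cast; ring
  rwa [hdeg] at this

/-- **F3.1 is incompatible with F7b-unit at any (37)-placement**: if no unit lies in `tilde P (−a)` for some `a > 0` (V3
`neg_proper` shape, here just for `u := 1`), F3.1 fails at that `P`. Scoring consequence: the literal F3.1 cell reads ✗ for every
F7b-candidate. [folklore] -/
theorem F31At_false_of_negProper (tildeP : ℤ → AddSubgroup B) (P : ℕ → Ideal B)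
    {q : ℕ} (hq : 0 < q) {g : B} (hg : g ∈ P q) (h37 : diffIdeal K q (Ideal.span {g}) = ⊤)
    {a : ℕ} (hproper : (1 : B) ∉ tildeP (-(a : ℤ))) : ¬ F31At K tildeP P :=
  fun h31 => hproper (F31At_forces_one_mem K tildeP P h31 hq hg h37 a)

end Lethal

/-! ## §5 E-G: V3's `diff_mem_neg` (all orders, order `0` included) forces `B`-stability of the negative pieces -/

section EG

variable (K : Type u) [CommRing K] {B : Type v} [CommRing B] [Algebra K B]

/-- **E-G.** `F3negAllAt` (V3 v0.4 `diff_mem_neg` at one `P`) makes every negative piece stable under multiplication by `B`: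
multiplication by `b` is a differential operator of order `≤ 0` (`isDiffOpLE_mulLeft`). [folklore] -/
theorem oStableNeg_of_F3negAll (tildeP : ℤ → AddSubgroup B) (h : F3negAllAt K tildeP)
    (i : ℤ) (hi : i < 0) (b x : B) (hx : x ∈ tildeP i) : b * x ∈ tildeP i := by
  have := h 0 (LinearMap.mulLeft K b) (isDiffOpLE_mulLeft (R := K) b) i hi x hx
  simpa using this

/-- Even WITHOUT order `0`: any order `c ≥ 1` contains the multiplications (`of_le`), so F3⁻ as printed (`c > 0`) still gives the
shifted stability `B · tilde P i ⊆ tilde P (i − c)`. [folklore] -/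
theorem mul_mem_shift_of_F3neg (tildeP : ℤ → AddSubgroup B) (h : F3negAt K tildeP) {c : ℕ} (hc : 0 < c)
    (i : ℤ) (hi : i < 0) (b x : B) (hx : x ∈ tildeP i) : b * x ∈ tildeP (i - c) := by
  have := h c (LinearMap.mulLeft K b) ((isDiffOpLE_mulLeft (R := K) b).of_le (Nat.zero_le c)) hc i hi x hx
  simpa using this

/-- **E-G consequence at a regular local placement of positive dimension**: F3⁻-all-orders + F6d NormDemand-shape (every element
of every negative piece is a `q`-th power, `q ≥ 2`) ⇒ ALL negative pieces vanish (tree squeeze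
`Lib.PowIdeal.addSubgroup_eq_bot_of_mul_mem_of_subset_range_pow`) — so F7c `NonVanishing` fails for every such inhabitant.
[folklore] -/
theorem tilde_neg_eq_bot_of_F3negAll_of_normDemand {O : Type v} [CommRing O] [Algebra K O] [IsRegularLocalRing O]
    (hm : maximalIdeal O ≠ ⊥) (tildeP : ℤ → AddSubgroup O) (h : F3negAllAt K tildeP) {q : ℕ} (hq : 2 ≤ q)
    (hN : ∀ a : ℕ, 0 < a → (tildeP (-(a : ℤ)) : Set O) ⊆ Set.range fun b : O => b ^ q)
    (a : ℕ) (ha : 0 < a) : tildeP (-(a : ℤ)) = ⊥ :=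
  Literature.AlgebraicGeometry.Hironaka2017.Lib.PowIdeal.addSubgroup_eq_bot_of_mul_mem_of_subset_range_pow hq hm
    (fun r x hx => oStableNeg_of_F3negAll K tildeP h _ (by omega) r x hx) (hN a ha)

/-- The same squeeze from F3⁻ AS PRINTED (`c > 0` only) — order `0` is not needed: `x ∈ tilde(−a)` with `B·x ⊆ tilde(−a−1) ⊆
{q-th powers}` already dies, because `z·x` for a regular parameter `z` would be a `q`-th power. Uses the tree's sharp squeeze
through the piece `H := {y | B·y ⊆ tilde(−a−1)}`… — recorded here in the simpler form: the SHIFTED piece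
`H_a := B-span-saturation` is `B`-stable and consists of `q`-th powers, hence `⊥`, and `tilde(−a) ⊆ H_a`. [folklore] -/
theorem tilde_neg_eq_bot_of_F3neg_of_normDemand {O : Type v} [CommRing O] [Algebra K O] [IsRegularLocalRing O]
    (hm : maximalIdeal O ≠ ⊥) (tildeP : ℤ → AddSubgroup O) (h : F3negAt K tildeP) {q : ℕ} (hq : 2 ≤ q)
    (hN : ∀ a : ℕ, 0 < a → (tildeP (-(a : ℤ)) : Set O) ⊆ Set.range fun b : O => b ^ q)
    (a : ℕ) (ha : 0 < a) : tildeP (-(a : ℤ)) = ⊥ := by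
  -- `H` = the elements all of whose `O`-multiples lie in `tilde(−a−1)`
  let H : AddSubgroup O :=
    { carrier := {x | ∀ b : O, b * x ∈ tildeP (-((a + 1 : ℕ) : ℤ))}
      zero_mem' := fun b => by rw [mul_zero]; exact AddSubgroup.zero_mem _
      add_mem' := fun {x y} hx hy b => by rw [mul_add]; exact AddSubgroup.add_mem _ (hx b) (hy b)
      neg_mem' := fun {x} hx b => by rw [mul_neg]; exact AddSubgroup.neg_mem _ (hx b) }
  have hH : H = ⊥ :=
    Literature.AlgebraicGeometry.Hironaka2017.Lib.PowIdeal.addSubgroup_eq_bot_of_mul_mem_of_subset_range_pow hq hm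
      (fun r x hx b => by rw [← mul_assoc]; exact hx (b * r))
      (fun x hx => by
        have := hx 1
        rw [one_mul] at this
        exact hN (a + 1) (by omega) this)
  refine (AddSubgroup.eq_bot_iff_forall _).2 fun x hx => ?_
  have hxH : x ∈ H := fun b => by
    have := mul_mem_shift_of_F3neg K tildeP h one_pos (-(a : ℤ)) (by omega) b x hx
    have hdeg : (-(a : ℤ) - (1 : ℕ)) = -((a + 1 : ℕ) : ℤ) := by push_cast; ring
    rwa [hdeg] at this
  rw [hH] at hxH
  exact (AddSubgroup.mem_bot).1 hxH

end EG


/-! ## §6 Over the checklist of record: `PnegaInterfaceV3.F31` and its kernel cell (typer res-L1-type-o2) -/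

end Summit.ResolutionOfSingularities.ResolutionOfSingularities.Theorems.Campaign.PnegaObligation

namespace Summit.ResolutionOfSingularities.ResolutionOfSingularities.Theorems.Campaign.PnegaInterfaceV3

open Literature.AlgebraicGeometry.Resolution

universe u v

variable {K : Type u} [CommRing K] {p : ℕ} {prov : PnegaProvenance.{u, v} K}

/-- [OURS · L1 G1 ℘nega-INTERFACE · obligation F3.1 over V3] replaces the role of the Diff-stability instance Th 7.11 (1) consumes
at p.38 L26–L28 (source = a positive piece `℘(E,j)`, target = the non-positive piece `℘̃(E,j−c)`, ALL operators of order `≤ c`,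
`c ≥ j > 0`) as a SCORED OBLIGATION on an inhabitant `I` of the checklist `PnegaInterfaceV3` (res-D-plan-1 V3 RULING 01:55:32Z C1:
«F3.1 … = SEPARATE named obligation def over the structure»): `PnegaObligation.F31 K I.tilde`. NOT a structure field, NOT a
statement of the manuscript, asserted of no candidate. VACUITY: NOT vacuous and NOT satisfiable by any inhabitant at a guarded
(37)-placement — `not_F31_of_datum` (kernel res-D-pv-031 §4 + the structure's F7b-unit); so the cell reads ✗ for everybody and the
discriminating content of «Th 7.11 (1)» sits in F3.2 / F3.3. [folklore] -/
def F31 (I : PnegaInterfaceV3 K p prov) : Prop :=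
  PnegaObligation.F31 K I.tilde

/-- Unfolding anchor (by `Iff.rfl`). [folklore] -/
theorem F31_iff (I : PnegaInterfaceV3 K p prov) :
    I.F31 ↔ ∀ {B : Type v} [CommRing B] [Algebra K B] (P : ℕ → Ideal B), IsCharFiltration K P →
      PnegaObligation.F31At K (I.tilde P) P :=
  Iff.rfl

/-- **Kernel cell F3.1 = ✗ for every inhabitant with a placement.** If some guarded filtration `P` carries a (37)-datum in the
checklist's sense (`0 < q`, `g ∈ P q`, unit clauses `∀ k > 0, diffIdeal K (k q) (span {g^k}) = ⊤`, `P q ≠ ⊤`), then NO inhabitant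
`I : PnegaInterfaceV3 K p prov` satisfies F3.1: `F31At` would put `1 ∈ I.tilde P (−1)` (`PnegaObligation.F31At_forces_one_mem`,
the `k = 1` clause), against the structure field F7b-unit `neg_proper`. (Such placements exist, e.g. res-type-087's origin
localisation `isCharFiltration_maximalIdeal_pow` / `diffIdeal_span_X_pow_eq_top_originLocalization_one`, p488544.) [folklore] -/
theorem not_F31_of_datum (I : PnegaInterfaceV3 K p prov) {B : Type v} [CommRing B] [Algebra K B] (P : ℕ → Ideal B)
    (hP : IsCharFiltration K P) (q : ℕ) (g : B) (hq : 0 < q) (hg : g ∈ P q)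
    (h37 : ∀ k : ℕ, 0 < k → diffIdeal K (k * q) (Ideal.span {g ^ k}) = ⊤) (hPq : P q ≠ ⊤) : ¬ I.F31 := by
  intro h
  have h1 : diffIdeal K q (Ideal.span {g}) = ⊤ := by simpa using h37 1 one_pos
  exact PnegaObligation.F31At_false_of_negProper K (I.tilde P) P hq hg h1 (a := 1)
    (I.neg_proper P hP q g hq hg h37 hPq 1 one_pos 1 isUnit_one) (h P hP)

end Summit.ResolutionOfSingularities.ResolutionOfSingularities.Theorems.Campaign.PnegaInterfaceV3

end
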